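import Mathlib
import Literature.Analysis.FluidPDE.SelfSimilarEulerVorticityLqBalance
import Literature.Analysis.FluidPDE.SelfSimilarEulerVorticityExteriorEstimate
import HarnessLib

/-!
# THE EULERIAN CHAE LAW: a self-similar Euler profile with bounded velocity gradient and `L^p` vorticity,
# `p(1 + sup‖DU‖) < 3γ`, is irrotational
# (nsreg-p2 SEEDS-R53 S2′, `r53/Seed53.lean` a18239281ab1c29f: `NsregP2.R53.Seeds.EulerianChaeLaw γ` VERBATIM; seat ns-ezl-w3 g8,
# `--supports stmt-NavierStokesRegularity-19832 --as helper`)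

Chae (CMP 273 (2007), Thm 1.1) excludes self-similar Euler blow-up when the vorticity profile lies in `L^p` for all
small `p` and `∫‖∇v‖_∞ dt < ∞`, by a Lagrangian argument. This file proves the EULERIAN, PROFILE-LEVEL form with an
explicit threshold, for the tree's stationary self-similar Euler profiles (`IsSelfSimilarEulerVorticityProfile γ c U`:
`U ∈ C²`, `div U = 0`, `Ω + (W·∇)Ω = (Ω·∇)U`, `Ω = curl U`, `W = γ(y−c) + U`; CIV 2026 (3.4)):

* `EulerianChae.curl_eq_zero_of_norm_fderiv_le` — if `‖DU‖ ≤ M` everywhere, `0 < p`, `p(1+M) < 3γ` and `‖Ω‖^p ∈ L¹(ℝ³)`,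
  then `curl U = 0` (no upper restriction on `p`);
* `EulerianChae.integrable_norm_curl_rpow_of_lintegral_ne_top` — `∫⁻ ‖Ω‖ₑ^p ≠ ⊤` with `Ω` continuous gives `‖Ω‖^p ∈ L¹`;
* ★ `EulerianChae.eulerianChaeLaw (γ)` — the planner's typed `NsregP2.R53.Seeds.EulerianChaeLaw γ`, token for token
  (velocity-form profiles `IsSelfSimilarEulerProfile γ c U P`, `0 < p ≤ 2`, `‖DU‖ ≤ M`, `p(1+M) < 3γ`, `∫⁻‖curl U‖ₑ^p ≠ ⊤`
  `⇒ ∀ y, curl U y = 0`); the hypothesis `p ≤ 2` is idle.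

## Proof

Everything is by name from the tree's Chae–Shvydkoy machinery. The `L^q`-vorticity balance
`IsSelfSimilarEulerVorticityProfile.vorticity_rpow_balance` (CS13 (4.2) against a compactly supported `C¹` weight `χ`,
any `q > 0`): `(3γ − q)∫χ‖Ω‖^q + ∫‖Ω‖^q Dχ(W) = −q∫χ‖Ω‖^{q−2}⟪DUΩ, Ω⟫`, is applied with `q = p` and the translated
Tao cut-offs `χ_L = θ_{2L,L}(· − c)` (`= 1` on `B̄(c,L)`, `= 0` off `B(c,2L)`, `|Dχ_L(y)w| ≤ (M_θ/L²)|⟪y−c, w⟫|`,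
`abs_fderiv_taoCutoff_comp_sub_apply_le`). The stretching is priced POINTWISE by the gradient bound,
`−‖Ω‖^{p−2}⟪DUΩ,Ω⟫ ≤ M‖Ω‖^p`, and the transport term by `‖W(y)‖ ≤ (γ+M)‖y−c‖ + ‖U(c)‖` (mean value inequality), so
that on the shell `L ≤ ‖y−c‖ ≤ 2L`, `L ≥ 1`: `|‖Ω‖^p Dχ_L(W)| ≤ K‖Ω‖^p` with `K = M_θ(4(γ+M) + 2‖U(c)‖)`. Hence
`(3γ − p(1+M))∫χ_L‖Ω‖^p ≤ K∫_{‖y−c‖ ≥ L}‖Ω‖^p`, and `L → ∞` (dominated convergence, `‖Ω‖^p ∈ L¹`) gives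
`(3γ − p(1+M))‖Ω‖_p^p ≤ 0`, i.e. `Ω ≡ 0` by continuity — exactly Chae's squeeze with `sup‖DU‖` in place of
`∫‖∇v‖_∞`, and the compact-support case is the tree's `curl_eq_zero_of_hasCompactSupport`.

HONEST FRAMING: Chae 2007 Thm 1.1 in Eulerian form = in print modulo form [cite: Chae2007SelfSimilarEuler, Thm 1.1 p.3;
ChaeShvydkoy2013, §4 Thm 4.1 (proof)]; an INSTRUMENT for ROUND-53 S2′, NOT a member for the `C²` needle survivor (which violates
`sup‖DV‖ < ∞`, SEEDS-R53 S2′ (iv)); nothing about the crux E `PowerGaugeEulerLiouville` (stmt 19832, OPEN) or NS regularity is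
proved here — MODEL-lattice crux class only.

## Mathlib / tree search

Reused: `IsSelfSimilarEulerVorticityProfile.vorticity_rpow_balance` (`SelfSimilarEulerVorticityLqBalance`), the translated
cut-off calculus `contDiff_taoCutoff_comp_sub`, `taoCutoff_comp_sub_eq_one/zero/mem_Icc`, `abs_fderiv_taoCutoff_comp_sub_apply_le`,
`fderiv_taoCutoff_comp_sub_eq_zero_of_lt/gt`, `exists_abs_deriv_smoothTransition_le` (`SelfSimilarEulerVorticityExteriorEstimate`,
`TaoEnergyLocalisationProofs`), `IsSelfSimilarEulerProfile.isSelfSimilarEulerVorticityProfile`, `contDiff_curl`; Mathlib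
`Convex.norm_image_sub_le_of_norm_fderiv_le`, `tendsto_integral_of_dominated_convergence`, `integral_eq_zero_iff_of_nonneg`,
`Continuous.ae_eq_iff_eq`. `lean search 'curl_eq_zero_of'`: `…of_hasCompactSupport`, `…of_integrable_rpow` (needs eventually SMALL
stretching + outward transport) — no bounded-gradient version was in the tree.
-/

noncomputable section

set_option linter.dupNamespace false

open Set Filter Topology Metric Function MeasureTheory InnerProductSpace
open scoped Topology ENNReal RealInnerProductSpace

namespace Summit.NavierStokesRegularity.NavierStokesRegularity.Theorems.PowerGaugeEulerLiouville

open Literature.Analysis Literature.Analysis.FluidPDE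

namespace EulerianChae

/-- **Bounded gradient + `L^p` vorticity below the threshold ⇒ irrotational** (Chae 2007 Thm 1.1, Eulerian profile form):
for a vorticity-form self-similar Euler profile with `‖DU‖ ≤ M` everywhere, `0 < p`, `p(1+M) < 3γ` and `‖curl U‖^p ∈ L¹(ℝ³)`,
`curl U = 0`. [cite: Chae2007SelfSimilarEuler, Thm 1.1 p.3; ChaeShvydkoy2013, §4 Thm 4.1 (proof)] -/
theorem curl_eq_zero_of_norm_fderiv_le {γ : ℝ} {c : EuclideanSpace ℝ (Fin 3)}
    {U : EuclideanSpace ℝ (Fin 3) → EuclideanSpace ℝ (Fin 3)} (h : IsSelfSimilarEulerVorticityProfile γ c U)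
    {p M : ℝ} (hp : 0 < p) (hM : ∀ y, ‖fderiv ℝ U y‖ ≤ M) (hpM : p * (1 + M) < 3 * γ)
    (hint : Integrable (fun y => ‖curl U y‖ ^ p)) : curl U = 0 := by
  set Ω : EuclideanSpace ℝ (Fin 3) → EuclideanSpace ℝ (Fin 3) := curl U with hΩdef
  set V : EuclideanSpace ℝ (Fin 3) → EuclideanSpace ℝ (Fin 3) := selfSimilarTransport γ c U with hVdef
  set fp : EuclideanSpace ℝ (Fin 3) → ℝ := fun y => ‖Ω y‖ ^ p with hfpdef
  have hM0 : 0 ≤ M := (norm_nonneg _).trans (hM c)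
  have hγ : 0 < γ := by nlinarith
  have hcoef : 0 < 3 * γ - p * (1 + M) := by linarith
  -- regularity
  have hU2 : ContDiff ℝ 2 U := h.contDiff_velocity
  have hU1 : ContDiff ℝ 1 U := hU2.of_le one_le_two
  have hUd : Differentiable ℝ U := hU1.differentiable one_ne_zero
  have hDUc : Continuous (fderiv ℝ U) := hU1.continuous_fderiv one_ne_zero
  have hΩ1 : ContDiff ℝ 1 Ω := contDiff_curl (n := 1) (by exact_mod_cast hU2)
  have hΩc : Continuous Ω := hΩ1.continuous
  have hVc : Continuous V := by
    have : V = fun y => γ • (y - c) + U y := by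
      funext y; rw [hVdef, selfSimilarTransport_apply]
    rw [this]
    exact ((continuous_id.sub continuous_const).const_smul γ).add hU1.continuous
  have hfp_cont : Continuous fp := hΩc.norm.rpow_const fun _ => Or.inr hp.le
  have hfp_nn : ∀ y, 0 ≤ fp y := fun y => Real.rpow_nonneg (norm_nonneg _) _
  -- the wind grows at most linearly: `‖V y‖ ≤ (γ + M)‖y − c‖ + ‖U c‖`
  have hMVT : ∀ y, ‖U y - U c‖ ≤ M * ‖y - c‖ := fun y =>
    convex_univ.norm_image_sub_le_of_norm_fderiv_le (fun x _ => hUd x) (fun x _ => hM x)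
      (mem_univ c) (mem_univ y)
  have hVnorm : ∀ y, ‖V y‖ ≤ (γ + M) * ‖y - c‖ + ‖U c‖ := by
    intro y
    have e : V y = γ • (y - c) + ((U y - U c) + U c) := by
      rw [hVdef, selfSimilarTransport_apply, sub_add_cancel]
    rw [e]
    calc ‖γ • (y - c) + ((U y - U c) + U c)‖
        ≤ ‖γ • (y - c)‖ + (‖U y - U c‖ + ‖U c‖) := (norm_add_le _ _).trans (by gcongr; exact norm_add_le _ _)
      _ ≤ γ * ‖y - c‖ + (M * ‖y - c‖ + ‖U c‖) := by
          rw [norm_smul, Real.norm_eq_abs, abs_of_pos hγ]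
          gcongr
          exact hMVT y
      _ = (γ + M) * ‖y - c‖ + ‖U c‖ := by ring
  -- the cut-off constant
  obtain ⟨Mθ, hMθ0, hMθ⟩ := exists_abs_deriv_smoothTransition_le
  set K : ℝ := Mθ * (4 * (γ + M) + 2 * ‖U c‖) with hKdef
  have hK0 : 0 ≤ K := by positivity
  -- cut-offs `χ_n = θ_{2(n+1), n+1}(· − c)` and tails `𝟙_{‖y−c‖ ≥ n+1} ‖Ω‖^p`
  set χn : ℕ → EuclideanSpace ℝ (Fin 3) → ℝ := fun n y =>
    taoCutoff (2 * ((n : ℝ) + 1)) ((n : ℝ) + 1) (y - c) with hχndef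
  set Tn : ℕ → EuclideanSpace ℝ (Fin 3) → ℝ := fun n y =>
    Set.indicator {y | ((n : ℝ) + 1) ≤ ‖y - c‖} fp y with hTndef
  have hLn : ∀ n : ℕ, (1 : ℝ) ≤ (n : ℝ) + 1 := fun n => by
    have : (0 : ℝ) ≤ n := Nat.cast_nonneg n
    linarith
  have hLpos : ∀ n : ℕ, (0 : ℝ) < (n : ℝ) + 1 := fun n => by positivity
  have hχn_mem : ∀ n y, χn n y ∈ Icc (0 : ℝ) 1 := fun n y => taoCutoff_comp_sub_mem_Icc _ c y
  have hχn_smooth : ∀ n, ContDiff ℝ 1 (χn n) := fun n =>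
    contDiff_taoCutoff_comp_sub (2 * ((n : ℝ) + 1)) ((n : ℝ) + 1) c
  have hχn_cont : ∀ n, Continuous (χn n) := fun n => (hχn_smooth n).continuous
  have hχn_supp : ∀ n, HasCompactSupport (χn n) := by
    intro n
    refine HasCompactSupport.of_support_subset_isCompact (isCompact_closedBall c (2 * ((n : ℝ) + 1)))
      fun z hz => ?_
    rw [mem_closedBall, dist_eq_norm]
    by_contra hcon
    exact hz (taoCutoff_comp_sub_eq_zero (hLpos n).le (not_le.1 hcon).le)
  have hmeas : ∀ n : ℕ, MeasurableSet {y : EuclideanSpace ℝ (Fin 3) | ((n : ℝ) + 1) ≤ ‖y - c‖} :=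
    fun n => (isClosed_le continuous_const (continuous_id.sub continuous_const).norm).measurableSet
  -- (1) THE STRETCHING IS PRICED BY THE GRADIENT BOUND: `−χ‖Ω‖^{p−2}⟪DUΩ,Ω⟫ ≤ M χ ‖Ω‖^p`
  have hstretch_pt : ∀ n y, -(χn n y * (‖Ω y‖ ^ (p - 2) * ⟪fderiv ℝ U y (Ω y), Ω y⟫)) ≤
      M * (χn n y * fp y) := by
    intro n y
    by_cases hω : Ω y = 0
    · simp only [hω, map_zero, inner_zero_right, mul_zero, neg_zero, hfpdef, norm_zero,
        Real.zero_rpow hp.ne']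
      exact le_rfl
    · have hpos : 0 < ‖Ω y‖ := norm_pos_iff.2 hω
      have hsplit : fp y = ‖Ω y‖ ^ (p - 2) * ‖Ω y‖ ^ 2 := by
        rw [hfpdef]
        simp only
        rw [← Real.rpow_natCast ‖Ω y‖ 2, ← Real.rpow_add hpos]
        congr 1; push_cast; ring
      have hin : -⟪fderiv ℝ U y (Ω y), Ω y⟫ ≤ M * ‖Ω y‖ ^ 2 := by
        have h1 : |⟪fderiv ℝ U y (Ω y), Ω y⟫| ≤ ‖fderiv ℝ U y (Ω y)‖ * ‖Ω y‖ :=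
          abs_real_inner_le_norm _ _
        have h2 : ‖fderiv ℝ U y (Ω y)‖ ≤ M * ‖Ω y‖ :=
          (ContinuousLinearMap.le_opNorm _ _).trans (mul_le_mul_of_nonneg_right (hM y) (norm_nonneg _))
        have h3 : ‖fderiv ℝ U y (Ω y)‖ * ‖Ω y‖ ≤ M * ‖Ω y‖ ^ 2 := by
          calc ‖fderiv ℝ U y (Ω y)‖ * ‖Ω y‖ ≤ M * ‖Ω y‖ * ‖Ω y‖ :=
                mul_le_mul_of_nonneg_right h2 (norm_nonneg _)
            _ = M * ‖Ω y‖ ^ 2 := by ring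
        have := neg_abs_le ⟪fderiv ℝ U y (Ω y), Ω y⟫
        linarith
      have hw : 0 ≤ χn n y * ‖Ω y‖ ^ (p - 2) := mul_nonneg (hχn_mem n y).1 (Real.rpow_nonneg hpos.le _)
      calc -(χn n y * (‖Ω y‖ ^ (p - 2) * ⟪fderiv ℝ U y (Ω y), Ω y⟫))
          = χn n y * ‖Ω y‖ ^ (p - 2) * (-⟪fderiv ℝ U y (Ω y), Ω y⟫) := by ring
        _ ≤ χn n y * ‖Ω y‖ ^ (p - 2) * (M * ‖Ω y‖ ^ 2) := mul_le_mul_of_nonneg_left hin hw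
        _ = M * (χn n y * fp y) := by rw [hsplit]; ring
  -- (2) THE TRANSPORT TERM LIVES ON THE SHELL: `|‖Ω‖^p Dχ_n(V)| ≤ K 𝟙_{‖y−c‖ ≥ n+1} ‖Ω‖^p`
  have htrans_pt : ∀ n y, |fp y * fderiv ℝ (χn n) y (V y)| ≤ K * Tn n y := by
    intro n y
    set L : ℝ := (n : ℝ) + 1 with hLdef
    have hL1 : 1 ≤ L := hLn n
    have hL0 : 0 < L := hLpos n
    by_cases hin : ‖y - c‖ < L
    · -- inside `B(c, L)` the cut-off is constant
      have hD : fderiv ℝ (χn n) y = 0 := fderiv_taoCutoff_comp_sub_eq_zero_of_lt hL0 hin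
      have hnot : y ∉ {y : EuclideanSpace ℝ (Fin 3) | L ≤ ‖y - c‖} := fun hm => by
        simp only [mem_setOf_eq] at hm; linarith
      rw [hD, zero_apply, mul_zero, abs_zero, hTndef]
      simp only
      rw [Set.indicator_of_notMem hnot, mul_zero]
    · have hyL : L ≤ ‖y - c‖ := not_lt.1 hin
      have hmem : y ∈ {y : EuclideanSpace ℝ (Fin 3) | L ≤ ‖y - c‖} := hyL
      have hT : Tn n y = fp y := by
        rw [hTndef]; simp only; rw [Set.indicator_of_mem hmem]
      rw [hT]
      by_cases hout : 2 * L < ‖y - c‖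
      · -- off `B̄(c, 2L)` the cut-off is constant
        have hD : fderiv ℝ (χn n) y = 0 := fderiv_taoCutoff_comp_sub_eq_zero_of_gt hL0.le hout
        rw [hD, zero_apply, mul_zero, abs_zero]
        exact mul_nonneg hK0 (hfp_nn y)
      · -- on the shell `L ≤ ‖y − c‖ ≤ 2L`
        have hy2L : ‖y - c‖ ≤ 2 * L := not_lt.1 hout
        have hD : |fderiv ℝ (χn n) y (V y)| ≤ Mθ / L ^ 2 * |⟪y - c, V y⟫| :=
          abs_fderiv_taoCutoff_comp_sub_apply_le hMθ hL0 c y (V y)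
        have hinner : |⟪y - c, V y⟫| ≤ 2 * L * ((γ + M) * (2 * L) + ‖U c‖) := by
          calc |⟪y - c, V y⟫| ≤ ‖y - c‖ * ‖V y‖ := abs_real_inner_le_norm _ _
            _ ≤ 2 * L * ((γ + M) * ‖y - c‖ + ‖U c‖) :=
                mul_le_mul hy2L (hVnorm y) (norm_nonneg _) (by positivity)
            _ ≤ 2 * L * ((γ + M) * (2 * L) + ‖U c‖) := by gcongr
        have hDK : |fderiv ℝ (χn n) y (V y)| ≤ K := by
          calc |fderiv ℝ (χn n) y (V y)| ≤ Mθ / L ^ 2 * |⟪y - c, V y⟫| := hD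
            _ ≤ Mθ / L ^ 2 * (2 * L * ((γ + M) * (2 * L) + ‖U c‖)) :=
                mul_le_mul_of_nonneg_left hinner (by positivity)
            _ = Mθ * (4 * (γ + M) + 2 * ‖U c‖ / L) := by field_simp; ring
            _ ≤ Mθ * (4 * (γ + M) + 2 * ‖U c‖ / 1) := by gcongr
            _ = K := by rw [hKdef, div_one]
        rw [abs_mul, abs_of_nonneg (hfp_nn y), mul_comm K]
        exact mul_le_mul_of_nonneg_left hDK (hfp_nn y)
  -- (3) THE LEVEL INEQUALITY: `(3γ − p(1+M)) ∫ χ_n ‖Ω‖^p ≤ K ∫ 𝟙_{‖y−c‖ ≥ n+1} ‖Ω‖^p`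
  have hIχ : ∀ n, Integrable (fun y => χn n y * fp y) := fun n =>
    ((hχn_cont n).mul hfp_cont).integrable_of_hasCompactSupport (hχn_supp n).mul_right
  have hIT : ∀ n, Integrable (Tn n) := fun n => hint.indicator (hmeas n)
  have hlevel : ∀ n : ℕ, (3 * γ - p * (1 + M)) * ∫ y, χn n y * fp y ≤ K * ∫ y, Tn n y := by
    intro n
    have hbal := h.vorticity_rpow_balance hp (hχn_smooth n) (hχn_supp n)
    -- stretching
    have hSint : Integrable (fun y => χn n y * (‖Ω y‖ ^ (p - 2) * ⟪fderiv ℝ U y (Ω y), Ω y⟫)) := by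
      refine Integrable.mono' ((hIχ n).const_mul M) ?_ (ae_of_all _ fun y => ?_)
      · exact ((hχn_cont n).measurable.mul ((hΩc.norm.measurable.pow_const _).mul
          ((hDUc.clm_apply hΩc).inner hΩc).measurable)).aestronglyMeasurable
      · rw [Real.norm_eq_abs]
        refine abs_le.2 ⟨by linarith [hstretch_pt n y], ?_⟩
        -- the same bound for `+`: `χ‖Ω‖^{p−2}⟪DUΩ,Ω⟫ ≤ Mχ‖Ω‖^p`
        by_cases hω : Ω y = 0
        · simp only [hω, map_zero, inner_zero_right, mul_zero, hfpdef, norm_zero, Real.zero_rpow hp.ne']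
          exact le_rfl
        · have hpos : 0 < ‖Ω y‖ := norm_pos_iff.2 hω
          have hsplit : fp y = ‖Ω y‖ ^ (p - 2) * ‖Ω y‖ ^ 2 := by
            rw [hfpdef]
            simp only
            rw [← Real.rpow_natCast ‖Ω y‖ 2, ← Real.rpow_add hpos]
            congr 1; push_cast; ring
          have hin' : ⟪fderiv ℝ U y (Ω y), Ω y⟫ ≤ M * ‖Ω y‖ ^ 2 := by
            have h1 : |⟪fderiv ℝ U y (Ω y), Ω y⟫| ≤ ‖fderiv ℝ U y (Ω y)‖ * ‖Ω y‖ :=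
              abs_real_inner_le_norm _ _
            have h2 : ‖fderiv ℝ U y (Ω y)‖ ≤ M * ‖Ω y‖ :=
              (ContinuousLinearMap.le_opNorm _ _).trans (mul_le_mul_of_nonneg_right (hM y) (norm_nonneg _))
            have h3 : ‖fderiv ℝ U y (Ω y)‖ * ‖Ω y‖ ≤ M * ‖Ω y‖ ^ 2 := by
              calc ‖fderiv ℝ U y (Ω y)‖ * ‖Ω y‖ ≤ M * ‖Ω y‖ * ‖Ω y‖ :=
                    mul_le_mul_of_nonneg_right h2 (norm_nonneg _)
                _ = M * ‖Ω y‖ ^ 2 := by ring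
            have := le_abs_self ⟪fderiv ℝ U y (Ω y), Ω y⟫
            linarith
          have hw : 0 ≤ χn n y * ‖Ω y‖ ^ (p - 2) :=
            mul_nonneg (hχn_mem n y).1 (Real.rpow_nonneg hpos.le _)
          calc χn n y * (‖Ω y‖ ^ (p - 2) * ⟪fderiv ℝ U y (Ω y), Ω y⟫)
              = χn n y * ‖Ω y‖ ^ (p - 2) * ⟪fderiv ℝ U y (Ω y), Ω y⟫ := by ring
            _ ≤ χn n y * ‖Ω y‖ ^ (p - 2) * (M * ‖Ω y‖ ^ 2) := mul_le_mul_of_nonneg_left hin' hw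
            _ = M * (χn n y * fp y) := by rw [hsplit]; ring
    have hS : -(p * ∫ y, χn n y * (‖Ω y‖ ^ (p - 2) * ⟪fderiv ℝ U y (Ω y), Ω y⟫)) ≤
        p * M * ∫ y, χn n y * fp y := by
      have h1 : ∫ y, -(χn n y * (‖Ω y‖ ^ (p - 2) * ⟪fderiv ℝ U y (Ω y), Ω y⟫)) ≤
          ∫ y, M * (χn n y * fp y) :=
        integral_mono hSint.neg ((hIχ n).const_mul M) fun y => hstretch_pt n y
      rw [integral_neg, integral_const_mul] at h1
      have := mul_le_mul_of_nonneg_left h1 hp.le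
      linarith
    -- transport
    have hTint : Integrable (fun y => fp y * fderiv ℝ (χn n) y (V y)) := by
      refine Integrable.mono' ((hIT n).const_mul K) ?_ (ae_of_all _ fun y => ?_)
      · exact (hfp_cont.mul (((hχn_smooth n).continuous_fderiv one_ne_zero).clm_apply hVc)).aestronglyMeasurable
      · rw [Real.norm_eq_abs]
        exact htrans_pt n y
    have hT : -(∫ y, fp y * fderiv ℝ (χn n) y (V y)) ≤ K * ∫ y, Tn n y := by
      have h1 : ∫ y, -(fp y * fderiv ℝ (χn n) y (V y)) ≤ ∫ y, K * Tn n y :=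
        integral_mono hTint.neg ((hIT n).const_mul K) fun y =>
          (neg_le_abs _).trans (htrans_pt n y)
      rwa [integral_neg, integral_const_mul] at h1
    -- combine with the balance `(3γ − p)A + T = −pS`
    have hbal' : (3 * γ - p) * (∫ y, χn n y * fp y) + ∫ y, fp y * fderiv ℝ (χn n) y (V y) =
        -p * ∫ y, χn n y * (‖Ω y‖ ^ (p - 2) * ⟪fderiv ℝ U y (Ω y), Ω y⟫) := hbal
    nlinarith [hbal', hS, hT]
  -- (4) `n → ∞`: `∫ χ_n ‖Ω‖^p → ∫ ‖Ω‖^p` and `∫ 𝟙_{‖y−c‖ ≥ n+1} ‖Ω‖^p → 0`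
  have hlimA : Tendsto (fun n => ∫ y, χn n y * fp y) atTop (𝓝 (∫ y, fp y)) := by
    refine tendsto_integral_of_dominated_convergence fp (fun n => (hIχ n).aestronglyMeasurable) hint
      (fun n => ae_of_all _ fun y => ?_) (ae_of_all _ fun y => ?_)
    · rw [Real.norm_eq_abs, abs_of_nonneg (mul_nonneg (hχn_mem n y).1 (hfp_nn y))]
      exact mul_le_of_le_one_left (hfp_nn y) (hχn_mem n y).2
    · have hχ_ev : ∀ᶠ n : ℕ in atTop, χn n y = 1 := by
        obtain ⟨N, hN⟩ := exists_nat_ge ‖y - c‖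
        refine Filter.eventually_atTop.2 ⟨N, fun n hn => ?_⟩
        have hn' : (N : ℝ) ≤ n := Nat.cast_le.2 hn
        exact taoCutoff_comp_sub_eq_one (by linarith) (by linarith)
      refine (tendsto_const_nhds (x := fp y)).congr' ?_
      filter_upwards [hχ_ev] with n hn
      rw [hn, one_mul]
  have hlimT : Tendsto (fun n => ∫ y, Tn n y) atTop (𝓝 (∫ _ : EuclideanSpace ℝ (Fin 3), (0 : ℝ))) := by
    refine tendsto_integral_of_dominated_convergence fp (fun n => (hIT n).aestronglyMeasurable) hint
      (fun n => ae_of_all _ fun y => ?_) (ae_of_all _ fun y => ?_)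
    · rw [hTndef]
      simp only
      rw [Real.norm_eq_abs]
      by_cases hy : y ∈ {y : EuclideanSpace ℝ (Fin 3) | ((n : ℝ) + 1) ≤ ‖y - c‖}
      · rw [Set.indicator_of_mem hy, abs_of_nonneg (hfp_nn y)]
      · rw [Set.indicator_of_notMem hy, abs_zero]
        exact hfp_nn y
    · obtain ⟨N, hN⟩ := exists_nat_ge ‖y - c‖
      refine tendsto_const_nhds.congr' ?_
      refine Filter.eventually_atTop.2 ⟨N, fun n hn => ?_⟩
      have hn' : (N : ℝ) ≤ n := Nat.cast_le.2 hn
      have hnot : y ∉ {y : EuclideanSpace ℝ (Fin 3) | ((n : ℝ) + 1) ≤ ‖y - c‖} := fun hmem => by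
        simp only [mem_setOf_eq] at hmem
        linarith
      simp only [hTndef, Set.indicator_of_notMem hnot]
  rw [integral_zero] at hlimT
  have hIle : (3 * γ - p * (1 + M)) * ∫ y, fp y ≤ K * 0 :=
    le_of_tendsto_of_tendsto (hlimA.const_mul _) (hlimT.const_mul K) (Eventually.of_forall hlevel)
  rw [mul_zero] at hIle
  -- (5) hence `∫ ‖Ω‖^p = 0` and `Ω ≡ 0`
  have hInn : 0 ≤ ∫ y, fp y := integral_nonneg hfp_nn
  have hI0 : ∫ y, fp y = 0 := by
    by_contra hne
    have hIpos : 0 < ∫ y, fp y := lt_of_le_of_ne hInn (Ne.symm hne)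
    nlinarith
  have hae : fp =ᵐ[volume] 0 := (integral_eq_zero_iff_of_nonneg hfp_nn hint).1 hI0
  have h0 : fp = 0 := (hfp_cont.ae_eq_iff_eq volume continuous_zero).1 hae
  funext y
  have hy : fp y = 0 := congrFun h0 y
  have hn : ‖Ω y‖ = 0 := by
    rcases (Real.rpow_eq_zero (norm_nonneg _) hp.ne').1 hy with h0'
    exact h0'
  simpa [hΩdef] using norm_eq_zero.1 hn

/-- `∫⁻ ‖Ω‖ₑ^p ≠ ⊤` for a continuous field `Ω` and `0 < p` means `‖Ω‖^p ∈ L¹` (real Bochner integrability). [folklore] -/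
theorem integrable_norm_rpow_of_lintegral_ne_top {Ω : EuclideanSpace ℝ (Fin 3) → EuclideanSpace ℝ (Fin 3)}
    (hΩ : Continuous Ω) {p : ℝ} (hp : 0 < p) (hfin : (∫⁻ y, ‖Ω y‖ₑ ^ p) ≠ ⊤) :
    Integrable (fun y => ‖Ω y‖ ^ p) := by
  refine ⟨(hΩ.norm.rpow_const fun _ => Or.inr hp.le).aestronglyMeasurable, ?_⟩
  rw [hasFiniteIntegral_iff_enorm]
  have e : ∀ y, ‖(‖Ω y‖ ^ p : ℝ)‖ₑ = ‖Ω y‖ₑ ^ p := fun y => by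
    rw [Real.enorm_eq_ofReal (Real.rpow_nonneg (norm_nonneg _) _),
      ← ENNReal.ofReal_rpow_of_nonneg (norm_nonneg _) hp.le, ofReal_norm]
  simp_rw [e]
  exact lt_top_iff_ne_top.2 hfin

/-- ★ **THE EULERIAN CHAE LAW** = nsreg-p2's typed `NsregP2.R53.Seeds.EulerianChaeLaw γ` VERBATIM (every centre; `γ > 0` is
forced by the threshold): a `C²` self-similar Euler profile `(U, P)` (CIV (3.3)) with bounded velocity gradient `‖DU‖ ≤ M` and
vorticity in `L^p`, `0 < p ≤ 2`, `p(1+M) < 3γ`, is irrotational. (The bound `p ≤ 2` is not used.) [cite: Chae2007SelfSimilarEuler, Thm 1.1 p.3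
(Eulerian form); ChaeShvydkoy2013, §4 Thm 4.1 (proof)] -/
theorem eulerianChaeLaw (γ : ℝ) :
    ∀ (c : EuclideanSpace ℝ (Fin 3)) (U : EuclideanSpace ℝ (Fin 3) → EuclideanSpace ℝ (Fin 3))
      (P : EuclideanSpace ℝ (Fin 3) → ℝ) (p M : ℝ), IsSelfSimilarEulerProfile γ c U P → 0 < p → p ≤ 2 →
      (∀ y, ‖fderiv ℝ U y‖ ≤ M) → p * (1 + M) < 3 * γ → (∫⁻ y, ‖curl U y‖ₑ ^ p) ≠ ⊤ →
        ∀ y, curl U y = 0 := by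
  intro c U P p M hprof hp _hp2 hM hpM hfin y
  have hΩc : Continuous (curl U) :=
    (contDiff_curl (n := 1) (by exact_mod_cast hprof.contDiff_velocity)).continuous
  have h0 : curl U = 0 :=
    curl_eq_zero_of_norm_fderiv_le hprof.isSelfSimilarEulerVorticityProfile hp hM hpM
      (integrable_norm_rpow_of_lintegral_ne_top hΩc hp hfin)
  exact congrFun h0 y

end EulerianChae

end Summit.NavierStokesRegularity.NavierStokesRegularity.Theorems.PowerGaugeEulerLiouville

end
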